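import Summits.MatrixMultiplication.MatrixMultiplication.Theorems.SnSubsetDichotomyThresholdSubsetTriplesChainDefs

/-!
# `SnSubsetDichotomy.ThresholdSubsetTriples`, line `interleaved-subsignature-ascent` — exact pair factorisation

Census c3a of crux `stmt-MatrixMultiplication-10882` (lead seat `prover-line-…-10882-1`), kernel-checked: for ANY set
`L` of levels, the two "owner" chain classes `S_A = subsig (ownerSystem L)` (full direction set `{0,…,k}` at the levels
`k ∈ L`, the identity letter only elsewhere) and `S_B = subsig (ownerSystem Lᶜ)` FACTORISE `S_n` EXACTLY: every
permutation is `s_A⁻¹ s_B` for exactly one pair (`stub_pairFactorisation`).  Consequences recorded in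
`Cruxes/ThresholdSubsetTriples/Census-c3a-PairFactorisation.md`: the pair map is injective with level pair-efficiency
`|D^A_k||D^B_k|/(k+1) = 1` at every level, so no "Shearer-type chain-PAIR inequality" can bound chain pairs away from the
pair packing bound (that named kill route of the line is void), and — since `1 ∈ S_A` — `Q(S_A)Q(S_B) ⊇ S_A⁻¹S_B = S_n`,
so an exactly factorising pair admits no third class: the third class of a TPP chain triple lives in the pair's slack.

Proof: induction on the levels `m ≤ n` for the lower classes `subsigBelow _ m` (`pairBoth_subsigBelow`), peeling the top
letter of the class that owns level `m` (`pair_step_surj`, `pair_step_inj`; the other class is trivial there) and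
flipping the pair by inversion when the owner is `A` (`pair_flip_surj`, `pair_flip_inj`).  Vocabulary (`starPiece`,
`subsigBelow`, `subsig`, `IsDirectionSystem`, `mem_starPiece`, `subsigBelow_apply_of_le`) from the landed
`SnSubsetDichotomyThresholdSubsetTriplesChainDefs`.  Elementary; Mathlib only.
-/

-- `Summit.<Summit>.<Problem>` is the tree's mandated summit-side namespace; for this single-conjunct summit the
-- two components coincide, so the file silences `dupNamespace` (same as the vocabulary file it imports).
set_option linter.dupNamespace false
set_option autoImplicit false

namespace Summit.MatrixMultiplication.MatrixMultiplication.Theorems.ThresholdSubsetTriples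

open scoped Pointwise

variable {n : ℕ}

/-- The OWNER direction system of a level set `L`: the full direction set `{d : d ≤ k}` at the levels `k ∈ L`
and the identity letter `{k}` only at the other levels. -/
def ownerSystem (L : Finset (Fin n)) : Fin n → Finset (Fin n) :=
  fun k => if k ∈ L then Finset.univ.filter (fun d => d ≤ k) else {k}

/-- Owner systems are direction systems (`d ≤ k` for `d ∈ D k`). -/
theorem ownerSystem_isDirectionSystem (L : Finset (Fin n)) : IsDirectionSystem (ownerSystem L) := by
  intro k d hd
  unfold ownerSystem at hd
  by_cases hk : k ∈ L
  · rw [if_pos hk, Finset.mem_filter] at hd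
    exact hd.2
  · rw [if_neg hk, Finset.mem_singleton] at hd
    exact le_of_eq hd

/-- At a level it owns, the owner system has the full direction set. -/
theorem ownerSystem_of_mem {L : Finset (Fin n)} {k : Fin n} (hk : k ∈ L) :
    ownerSystem L k = Finset.univ.filter (fun d => d ≤ k) := by
  unfold ownerSystem
  rw [if_pos hk]

/-- At a level it does not own, the owner system has only the identity letter. -/
theorem ownerSystem_of_not_mem {L : Finset (Fin n)} {k : Fin n} (hk : k ∉ L) :
    ownerSystem L k = {k} := by
  unfold ownerSystem
  rw [if_neg hk]

/-- The star piece of the identity letter alone is the trivial piece `{1}`. -/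
theorem starPiece_singleton_self (t : Fin n) : starPiece ({t} : Finset (Fin n)) t = {1} := by
  unfold starPiece
  rw [Finset.image_singleton, Equiv.swap_self]
  rfl

/-- A permutation fixing every point above `t` maps points `≤ t` to points `≤ t`. -/
theorem apply_le_of_fix_above {t : Fin n} {σ : Equiv.Perm (Fin n)} (hσ : ∀ p : Fin n, t < p → σ p = p)
    {y : Fin n} (hy : y ≤ t) : σ y ≤ t := by
  by_contra h
  have h' : t < σ y := not_le.1 h
  have h1 : σ (σ y) = σ y := hσ _ h'

  have h2 : σ y = y := σ.injective h1
  rw [h2] at h'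
  exact absurd hy (not_le.2 h')

/-! ## One peeling step: `X` trivial at the token `t`, `Y = starPiece {d ≤ t} t * Ylow` -/

/-- Surjectivity step.  If every permutation fixing the points `≥ t` is `a⁻¹ b` with `a ∈ X`, `b ∈ Ylow`, and the
elements of `X` fix the points `≥ t`, then every permutation fixing the points `> t` is `a⁻¹ b'` with `a ∈ X` and
`b'` in the extended class `starPiece {d ≤ t} t * Ylow`. -/
theorem pair_step_surj (X Ylow : Finset (Equiv.Perm (Fin n))) (t : Fin n)
    (hX : ∀ a ∈ X, ∀ p : Fin n, t ≤ p → a p = p)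
    (IH : ∀ σ : Equiv.Perm (Fin n), (∀ p : Fin n, t ≤ p → σ p = p) → ∃ a ∈ X, ∃ b ∈ Ylow, a⁻¹ * b = σ) :
    ∀ σ : Equiv.Perm (Fin n), (∀ p : Fin n, t < p → σ p = p) →
      ∃ a ∈ X, ∃ b ∈ starPiece (Finset.univ.filter (fun d => d ≤ t)) t * Ylow, a⁻¹ * b = σ := by
  intro σ hσ
  set y := σ t with hy
  have hyle : y ≤ t := apply_le_of_fix_above hσ le_rfl
  -- `σ₁ := swap y t * σ` fixes the points `≥ t`
  have hσ₁ : ∀ p : Fin n, t ≤ p → (Equiv.swap y t * σ) p = p := by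
    intro p hp
    rcases eq_or_lt_of_le hp with h | h
    · subst h
      rw [Equiv.Perm.mul_apply, ← hy, Equiv.swap_apply_left]
    · rw [Equiv.Perm.mul_apply, hσ p h]
      exact Equiv.swap_apply_of_ne_of_ne (fun hpy => absurd (hpy ▸ hyle) (not_le.2 h)) (ne_of_gt h)
  obtain ⟨a, ha, b, hb, hab⟩ := IH _ hσ₁
  have hat : a t = t := hX a ha t le_rfl
  have hay : a y ≤ t := apply_le_of_fix_above (fun p hp => hX a ha p hp.le) hyle
  refine ⟨a, ha, Equiv.swap (a y) t * b, Finset.mul_mem_mul ?_ hb, ?_⟩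
  · exact mem_starPiece.2 ⟨a y, Finset.mem_filter.2 ⟨Finset.mem_univ _, hay⟩, rfl⟩
  · have hconj : Equiv.swap (a y) t = a * Equiv.swap y t * a⁻¹ := by
      conv_lhs => rw [← hat]
      exact Equiv.swap_apply_apply a y t
    calc a⁻¹ * (Equiv.swap (a y) t * b) = Equiv.swap y t * (a⁻¹ * b) := by rw [hconj]; group
      _ = Equiv.swap y t * (Equiv.swap y t * σ) := by rw [hab]
      _ = σ := by rw [← mul_assoc, Equiv.swap_mul_self, one_mul]

/-- Injectivity step.  If `a⁻¹ b` determines `(a, b) ∈ X × Ylow` and the elements of `X` and of `Ylow` fix `t`,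
then `a⁻¹ b'` determines `(a, b') ∈ X × (starPiece {d ≤ t} t * Ylow)`. -/
theorem pair_step_inj (X Ylow : Finset (Equiv.Perm (Fin n))) (t : Fin n)
    (hX : ∀ a ∈ X, a t = t) (hY : ∀ b ∈ Ylow, b t = t)
    (IH : ∀ a ∈ X, ∀ a' ∈ X, ∀ b ∈ Ylow, ∀ b' ∈ Ylow, a⁻¹ * b = a'⁻¹ * b' → a = a' ∧ b = b') :
    ∀ a ∈ X, ∀ a' ∈ X, ∀ b ∈ starPiece (Finset.univ.filter (fun d => d ≤ t)) t * Ylow,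
      ∀ b' ∈ starPiece (Finset.univ.filter (fun d => d ≤ t)) t * Ylow,
        a⁻¹ * b = a'⁻¹ * b' → a = a' ∧ b = b' := by
  intro a ha a' ha' b hb b' hb' heq
  obtain ⟨p, hp, c, hc, rfl⟩ := Finset.mem_mul.1 hb
  obtain ⟨p', hp', c', hc', rfl⟩ := Finset.mem_mul.1 hb'
  obtain ⟨e, -, rfl⟩ := mem_starPiece.1 hp
  obtain ⟨e', -, rfl⟩ := mem_starPiece.1 hp'
  -- conjugate the star letters through `a⁻¹`, `a'⁻¹`
  have hat : a⁻¹ t = t := by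
    rw [Equiv.Perm.inv_eq_iff_eq]
    exact (hX a ha).symm
  have hat' : a'⁻¹ t = t := by
    rw [Equiv.Perm.inv_eq_iff_eq]
    exact (hX a' ha').symm
  have hc1 : a⁻¹ * (Equiv.swap e t * c) = Equiv.swap (a⁻¹ e) t * (a⁻¹ * c) := by
    have hconj : Equiv.swap (a⁻¹ e) t = a⁻¹ * Equiv.swap e t * a⁻¹⁻¹ := by
      conv_lhs => rw [← hat]
      exact Equiv.swap_apply_apply a⁻¹ e t
    rw [hconj]
    group
  have hc2 : a'⁻¹ * (Equiv.swap e' t * c') = Equiv.swap (a'⁻¹ e') t * (a'⁻¹ * c') := by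
    have hconj : Equiv.swap (a'⁻¹ e') t = a'⁻¹ * Equiv.swap e' t * a'⁻¹⁻¹ := by
      conv_lhs => rw [← hat']
      exact Equiv.swap_apply_apply a'⁻¹ e' t
    rw [hconj]
    group
  rw [hc1, hc2] at heq
  -- evaluate at `t`: the two conjugated letters coincide
  have hyy : a⁻¹ e = a'⁻¹ e' := by
    have h := congrArg (fun π : Equiv.Perm (Fin n) => π t) heq
    simp only [Equiv.Perm.mul_apply] at h
    rw [hY c hc, hY c' hc', hat, hat', Equiv.swap_apply_right, Equiv.swap_apply_right] at h
    exact h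
  rw [hyy] at heq
  have heq' : a⁻¹ * c = a'⁻¹ * c' := mul_left_cancel heq
  obtain ⟨haa, hcc⟩ := IH a ha a' ha' c hc c' hc' heq'
  subst haa
  subst hcc
  have hee : e = e' := by simpa using hyy
  subst hee
  exact ⟨rfl, rfl⟩

/-! ## Flipping a pair by inversion -/

/-- Surjectivity is symmetric in the two classes (`(a⁻¹ b)⁻¹ = b⁻¹ a`). -/
theorem pair_flip_surj (X Y : Finset (Equiv.Perm (Fin n))) (m : ℕ)
    (h : ∀ σ : Equiv.Perm (Fin n), (∀ p : Fin n, m ≤ (p : ℕ) → σ p = p) → ∃ a ∈ X, ∃ b ∈ Y, a⁻¹ * b = σ) :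
    ∀ σ : Equiv.Perm (Fin n), (∀ p : Fin n, m ≤ (p : ℕ) → σ p = p) → ∃ b ∈ Y, ∃ a ∈ X, b⁻¹ * a = σ := by
  intro σ hσ
  have hσ' : ∀ p : Fin n, m ≤ (p : ℕ) → σ⁻¹ p = p := by
    intro p hp
    rw [Equiv.Perm.inv_eq_iff_eq]
    exact (hσ p hp).symm
  obtain ⟨a, ha, b, hb, hab⟩ := h σ⁻¹ hσ'
  refine ⟨b, hb, a, ha, ?_⟩
  have := congrArg (fun π : Equiv.Perm (Fin n) => π⁻¹) hab
  simpa using this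

/-- Injectivity is symmetric in the two classes. -/
theorem pair_flip_inj (X Y : Finset (Equiv.Perm (Fin n)))
    (h : ∀ a ∈ X, ∀ a' ∈ X, ∀ b ∈ Y, ∀ b' ∈ Y, a⁻¹ * b = a'⁻¹ * b' → a = a' ∧ b = b') :
    ∀ b ∈ Y, ∀ b' ∈ Y, ∀ a ∈ X, ∀ a' ∈ X, b⁻¹ * a = b'⁻¹ * a' → b = b' ∧ a = a' := by
  intro b hb b' hb' a ha a' ha' heq
  have heq' : a⁻¹ * b = a'⁻¹ * b' := by
    have := congrArg (fun π : Equiv.Perm (Fin n) => π⁻¹) heq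
    simpa using this
  obtain ⟨h1, h2⟩ := h a ha a' ha' b hb b' hb' heq'
  exact ⟨h2, h1⟩

/-! ## The induction over levels -/

/-- Exact factorisation of the permutations fixing the points `≥ m` by the lower owner classes
`subsigBelow (ownerSystem L) m` and `subsigBelow (ownerSystem Lᶜ) m` (surjectivity and injectivity of
`(a, b) ↦ a⁻¹ b`), for every `m ≤ n`. -/
theorem pairBoth_subsigBelow (L : Finset (Fin n)) :
    ∀ m : ℕ, m ≤ n →
      (∀ σ : Equiv.Perm (Fin n), (∀ p : Fin n, m ≤ (p : ℕ) → σ p = p) →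
          ∃ a ∈ subsigBelow (ownerSystem L) m, ∃ b ∈ subsigBelow (ownerSystem Lᶜ) m, a⁻¹ * b = σ) ∧
      (∀ a ∈ subsigBelow (ownerSystem L) m, ∀ a' ∈ subsigBelow (ownerSystem L) m,
          ∀ b ∈ subsigBelow (ownerSystem Lᶜ) m, ∀ b' ∈ subsigBelow (ownerSystem Lᶜ) m,
            a⁻¹ * b = a'⁻¹ * b' → a = a' ∧ b = b') := by
  intro m
  induction m with
  | zero =>
    intro _
    refine ⟨?_, ?_⟩
    · intro σ hσ
      refine ⟨1, by simp [subsigBelow_zero], 1, by simp [subsigBelow_zero], ?_⟩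
      rw [inv_one, one_mul]
      ext p
      exact congrArg Fin.val (hσ p (Nat.zero_le _)).symm
    · intro a ha a' ha' b hb b' hb' _
      rw [subsigBelow_zero, Finset.mem_singleton] at ha ha' hb hb'
      subst ha; subst ha'; subst hb; subst hb'
      exact ⟨rfl, rfl⟩
  | succ m ih =>
    intro hm
    have hmn : m < n := Nat.lt_of_succ_le hm
    obtain ⟨ihS, ihI⟩ := ih hmn.le
    set t : Fin n := ⟨m, hmn⟩ with ht
    have hDA := ownerSystem_isDirectionSystem L
    have hDB := ownerSystem_isDirectionSystem Lᶜ
    -- the lower classes fix the points `≥ m`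
    have fixA : ∀ a ∈ subsigBelow (ownerSystem L) m, ∀ p : Fin n, t ≤ p → a p = p :=
      fun a ha p hp => subsigBelow_apply_of_le _ hDA m a ha p hp
    have fixB : ∀ b ∈ subsigBelow (ownerSystem Lᶜ) m, ∀ p : Fin n, t ≤ p → b p = p :=
      fun b hb p hp => subsigBelow_apply_of_le _ hDB m b hb p hp
    -- rewrite the two successor classes
    rw [subsigBelow_succ_of_lt _ hmn, subsigBelow_succ_of_lt _ hmn]
    -- thresholds: `m + 1 ≤ p` iff `t < p`, and `m ≤ p` iff `t ≤ p`
    have thr : ∀ p : Fin n, (m + 1 ≤ (p : ℕ) ↔ t < p) := fun p => by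
      rw [Fin.lt_def]; exact Iff.rfl
    have thr' : ∀ p : Fin n, (m ≤ (p : ℕ) ↔ t ≤ p) := fun p => by
      rw [Fin.le_def]
    by_cases hL : t ∈ L
    · -- `A` owns level `m`: `B` is trivial there; flip, step, flip back
      have hBt : (⟨m, hmn⟩ : Fin n) ∉ Lᶜ := fun h => (Finset.mem_compl.1 h) hL
      rw [ownerSystem_of_mem hL, ownerSystem_of_not_mem hBt, starPiece_singleton_self,
        Finset.singleton_one, one_mul]
      have ihS' := pair_flip_surj _ _ m ihS
      have ihI' := pair_flip_inj _ _ ihI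
      have stepS := pair_step_surj (subsigBelow (ownerSystem Lᶜ) m) (subsigBelow (ownerSystem L) m) t fixB
        (fun σ hσ => ihS' σ (fun p hp => hσ p ((thr' p).2 hp)))
      have stepI := pair_step_inj (subsigBelow (ownerSystem Lᶜ) m) (subsigBelow (ownerSystem L) m) t
        (fun b hb => fixB b hb t le_rfl) (fun a ha => fixA a ha t le_rfl) ihI'
      refine ⟨?_, ?_⟩
      · intro σ hσ
        have hσ' : ∀ p : Fin n, t < p → σ⁻¹ p = p := by
          intro p hp
          rw [Equiv.Perm.inv_eq_iff_eq]
          exact (hσ p ((thr p).2 hp)).symm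
        obtain ⟨b, hb, a, ha, hba⟩ := stepS σ⁻¹ hσ'
        refine ⟨a, ha, b, hb, ?_⟩
        have := congrArg (fun π : Equiv.Perm (Fin n) => π⁻¹) hba
        simpa using this
      · intro a ha a' ha' b hb b' hb' heq
        have heq' : b⁻¹ * a = b'⁻¹ * a' := by
          have := congrArg (fun π : Equiv.Perm (Fin n) => π⁻¹) heq
          simpa using this
        obtain ⟨h1, h2⟩ := stepI b hb b' hb' a ha a' ha' heq'
        exact ⟨h2, h1⟩
    · -- `B` owns level `m`: direct step
      have hBt : (⟨m, hmn⟩ : Fin n) ∈ Lᶜ := Finset.mem_compl.2 hL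
      rw [ownerSystem_of_not_mem hL, ownerSystem_of_mem hBt, starPiece_singleton_self,
        Finset.singleton_one, one_mul]
      have stepS := pair_step_surj (subsigBelow (ownerSystem L) m) (subsigBelow (ownerSystem Lᶜ) m) t fixA
        (fun σ hσ => ihS σ (fun p hp => hσ p ((thr' p).2 hp)))
      have stepI := pair_step_inj (subsigBelow (ownerSystem L) m) (subsigBelow (ownerSystem Lᶜ) m) t
        (fun a ha => fixA a ha t le_rfl) (fun b hb => fixB b hb t le_rfl) ihI
      exact ⟨fun σ hσ => stepS σ (fun p hp => hσ p ((thr p).2 hp)), stepI⟩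

/-- **Exact pair factorisation (stub `stub_pairFactorisation`, census c3a).**  For every level set `L`, every
permutation of `Fin n` is `s_A⁻¹ s_B` for exactly ONE pair `(s_A, s_B)` of words of the owner chain classes
`subsig (ownerSystem L)` and `subsig (ownerSystem Lᶜ)`.  Hence `|S_A||S_B| = n!` with the pair map injective and
level pair-efficiency `1` at every level: chain PAIRS reach the pair packing bound exactly, for every ownership
pattern, so no inequality on pair level data can bound chain triples away from threshold. [folklore-type; proved here] -/
theorem stub_pairFactorisation {n : ℕ} (L : Finset (Fin n)) (σ : Equiv.Perm (Fin n)) :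
    ∃! p : Equiv.Perm (Fin n) × Equiv.Perm (Fin n),
      p.1 ∈ subsig (ownerSystem L) ∧ p.2 ∈ subsig (ownerSystem Lᶜ) ∧ p.1⁻¹ * p.2 = σ := by
  obtain ⟨hS, hI⟩ := pairBoth_subsigBelow L n le_rfl
  obtain ⟨a, ha, b, hb, hab⟩ := hS σ (fun p hp => absurd p.isLt (not_lt.2 hp))
  refine ⟨(a, b), ⟨ha, hb, hab⟩, ?_⟩
  rintro ⟨a', b'⟩ ⟨ha', hb', hab'⟩
  obtain ⟨h1, h2⟩ := hI a' ha' a ha b' hb' b hb (hab'.trans hab.symm)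
  simp [h1, h2]

end Summit.MatrixMultiplication.MatrixMultiplication.Theorems.ThresholdSubsetTriples
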